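import Summits.BirchSwinnertonDyer.BirchSwinnertonDyer.Theorems.ManinLocalTwoThreeManinPrimeToThreeOfReducibleOfCuspidalKummer
import Summits.BirchSwinnertonDyer.BirchSwinnertonDyer.Theorems.ManinLocalTwoThreeManinThreeKummerCube
import Summits.BirchSwinnertonDyer.Rank1Residual.ManinAdditive.CuspidalKummerCubeLaws
import HarnessLib

/-!
# C3 BY NAME: `ManinPrimeToThreeAtNine ⟸ F-es-18 ∧ E-an-57 ∧ LAW₃ ∧ RES₃(′)`, with E-an-55 discharged

Summit `BirchSwinnertonDyer`, route `ManinLocalTwoThree` (cell bsd-f2-manin), crux C3 `ManinPrimeToThreeAtNine` (stmt-BirchSwinnertonDyer-22968),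
line `kato_shift_three`, skeleton v8 (registered; stubs F-es-18, E-an-57, LAW₃, RES₃′).  The lead's p621918 stated LAW₃ and RES₃(′) inline;
the cell typer has since filed them as the leaves `CuspidalKummerThree.CuspidalKummerCubeExponentLaw`,
`…NoRationalThreeTorsionResidual`, `…NoRationalThreeTorsionOrbitMinimalResidual` (p622781), and p3 g5 PROVED E-an-55
(`ManinThreeKummerCube_holds`, p623988).  This file restates the C3 ledger with every hypothesis a NAMED tree declaration:

* `maninPrimeToThreeOfReducible_of_namedCubeLaws : E-an-57 → LAW₃ → RES₃ → ManinPrimeToThreeOfReducible`;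
* `maninPrimeToThreeAtNine_of_katoFact_of_namedCubeLaws : F-es-18 → E-an-57 → LAW₃ → RES₃′ → ManinPrimeToThreeAtNine` (= skeleton v8's
  composition, usable by name).

CONDITIONAL; nothing about BSD or Manin's conjecture is proved. [folklore]
-/

set_option autoImplicit false
set_option linter.dupNamespace false

noncomputable section

open scoped Classical MatrixGroups ModularForm
open WeierstrassCurve Literature.NumberTheory.EllipticCurves Literature.NumberTheory.EllipticCurves.ModularForms
open Summit.BirchSwinnertonDyer.Rank1Residual.ManinAdditive
open Summit.BirchSwinnertonDyer.Rank1Residual.ManinAdditive.CuspidalKummer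
open Summit.BirchSwinnertonDyer.Rank1Residual.ManinAdditive.CuspidalKummerThree

namespace Summit.BirchSwinnertonDyer.BirchSwinnertonDyer.Theorems.ManinLocalTwoThree

/-- **The reducible residual of C3 from three NAMED open rows** (E-an-57 K_geo₃, LAW₃, RES₃), E-an-55 being p3's theorem.
CONDITIONAL. [folklore] -/
theorem maninPrimeToThreeOfReducible_of_namedCubeLaws (h57 : CuspidalKummerCubeRepresentativeAtNine)
    (hLaw : CuspidalKummerCubeExponentLaw) (hRes : NoRationalThreeTorsionResidual) : ManinPrimeToThreeOfReducible :=
  maninPrimeToThreeOfReducible_of_cuspidalKummerCube h57 ManinThreeKummerCube_holds hLaw hRes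

/-- **C3 `ManinPrimeToThreeAtNine` BY NAME from F-es-18, E-an-57, LAW₃ and the orbit-minimal residual RES₃′** — skeleton v8 of line
`kato_shift_three`, every stub a named tree declaration.  CONDITIONAL. [cite: Kato2004Asterisque, Thm. 9.7 (p. 189)] -/
theorem maninPrimeToThreeAtNine_of_katoFact_of_namedCubeLaws
    (hK : kato_neron_isIntegral_twistedSymbolSum_of_additive_three_polar)
    (h57 : CuspidalKummerCubeRepresentativeAtNine) (hLaw : CuspidalKummerCubeExponentLaw)
    (hRes : NoRationalThreeTorsionOrbitMinimalResidual) :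
    Summit.BirchSwinnertonDyer.BirchSwinnertonDyer.Theses.ManinLocalTwoThree.ManinPrimeToThreeAtNine :=
  maninPrimeToThreeAtNine_of_katoFact_of_cuspidalKummerCube_of_orbitMinimal hK h57 ManinThreeKummerCube_holds hLaw hRes

/-- The same with the plain residual RES₃ (which implies RES₃′). CONDITIONAL. [cite: Kato2004Asterisque, Thm. 9.7 (p. 189)] -/
theorem maninPrimeToThreeAtNine_of_katoFact_of_namedCubeLaws'
    (hK : kato_neron_isIntegral_twistedSymbolSum_of_additive_three_polar)
    (h57 : CuspidalKummerCubeRepresentativeAtNine) (hLaw : CuspidalKummerCubeExponentLaw)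
    (hRes : NoRationalThreeTorsionResidual) :
    Summit.BirchSwinnertonDyer.BirchSwinnertonDyer.Theses.ManinLocalTwoThree.ManinPrimeToThreeAtNine :=
  maninPrimeToThreeAtNine_of_katoFact_of_reducible hK (maninPrimeToThreeOfReducible_of_namedCubeLaws h57 hLaw hRes)

end Summit.BirchSwinnertonDyer.BirchSwinnertonDyer.Theorems.ManinLocalTwoThree

end
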